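import Mathlib
import HarnessLib
import Literature.Computability.AlgebraicComplexity.ArithCircuitProofs
import Summits.ValiantsHypothesis.ValiantsHypothesis.Theorems.MonotoneRestorationOrbitRestorationQPSmlAffineRowRestoration
import Summits.ValiantsHypothesis.ValiantsHypothesis.Theorems.MonotoneRestorationNonnegRestorationQPSmlNonnegInstance
import Summits.ValiantsHypothesis.ValiantsHypothesis.Theorems.MonotoneRestorationOrbitRestorationQPSmlAffinePermanent
import Summits.ValiantsHypothesis.ValiantsHypothesis.Theorems.ProjectionStabilityUniqStepStubSwapBookkeeping

/-!
# `OrbitRestorationQP` HOLDS on the affine set-multilinear class (certified sub-case), and the row-side permanent bound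
(crux `OrbitRestorationQP`, stmt-ValiantsHypothesis-18293 — lane SML of stub A_∞ `stub_sigmaPiSigmaValue`)

The crux `OrbitRestorationQP` quantifies over matrix-symmetric `VP` families.  The affine set-multilinear families of the lane
(`SmlAffineRestoration.affineSml_restoration`: at each level an affine column- OR row-set-multilinear `ΣΠΣ` expression with at most
`n^c + c` product gates) satisfy its HYPOTHESIS — they are `VP` families (`SmlAffineRestoration.isVPFamily_of_affineColSml` and
transposition) — and its CONCLUSION (square-symmetric circuits of quasi-polynomial ORBIT size).  So the crux holds on the class:

* `isVPFamily_of_affineSml` — families with affine column- or row-sml expressions of at most `n^c + c` product gates are `VP`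
  families (`complexity_rename_le` moves the row side to the column side);
* `orbitRestorationQP_on_affineSml` — **hypothesis and conclusion of `OrbitRestorationQP` for every matrix-symmetric family of
  the class** (conclusion in the crux's exact shape: `∃ c, ∀ n, ∃ G C, C.IsSymmetric ∧ C.eval (C.output ()) = f n ∧
  C.orbitSize ≤ 2^((log₂ n + c)^c)`);
* `perm_affineRowSml_lower_bound` — the permanent is its own transpose (tree: `ProjectionStabilityUniqStep.rename_swap_perPoly`), so the exponential lower bound
  `s ≥ C(n-j, j)` of `…SmlAffinePermanent.lean` also holds for affine ROW-set-multilinear expressions of `per_n`.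

Together: inside the class the crux is a theorem, and the route's deciding family `per` is provably OUTSIDE the class at
polynomial (indeed subexponential `2^{o(n)}`) cost.  Honest label: certified sub-case + restricted-model lower bound; the crux
itself (all matrix-symmetric `VP` families) stays open; VP ≠ VNP untouched. [folklore]
-/

noncomputable section

open scoped Classical

-- `Summit.ValiantsHypothesis.ValiantsHypothesis.…` is the tree's single-conjunct layout (Sub = Summit).
set_option linter.dupNamespace false

namespace Summit.ValiantsHypothesis.ValiantsHypothesis.Theorems.SmlAffineRestoration

open MvPolynomial Finset Equiv Literature.Computability.AlgebraicComplexity OrbitRestorationQPDepthThreeRung SmlRestoration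
  SmlAffinePermanent

/-! ### The class lies in `VP` (both sides) -/

/-- A row-set-multilinear expression is the transpose of the column-set-multilinear expression with the same tables. [folklore] -/
theorem affineRowSml_eq_rename_swap {n s : ℕ} (β : Fin s → Fin n → ℂ) (α : Fin s → Fin n → Fin n → ℂ) :
    (∑ t : Fin s, ∏ a : Fin n, (C (β t a) + ∑ b : Fin n, C (α t a b) * X (a, b)) : MvPolynomial (Fin n × Fin n) ℂ) =
      rename (Prod.swap : Fin n × Fin n → Fin n × Fin n)
        (∑ t : Fin s, ∏ b : Fin n, (C (β t b) + ∑ a : Fin n, C (α t b a) * X (a, b))) := by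
  rw [← rename_swap_affineRowSml β α, rename_rename]
  simp only [Prod.swap_swap_eq, rename_id, AlgHom.id_apply]

/-- **Families with small affine column- OR row-sml expressions are `VP` families.** [folklore] -/
theorem isVPFamily_of_affineSml (f : (n : ℕ) → MvPolynomial (Fin n × Fin n) ℂ) {c : ℕ}
    (hcirc : ∀ n : ℕ, ∃ (s : ℕ) (β : Fin s → Fin n → ℂ) (α : Fin s → Fin n → Fin n → ℂ), s ≤ n ^ c + c ∧
      (f n = ∑ t : Fin s, ∏ b : Fin n, (C (β t b) + ∑ a : Fin n, C (α t b a) * X (a, b)) ∨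
       f n = ∑ t : Fin s, ∏ a : Fin n, (C (β t a) + ∑ b : Fin n, C (α t a b) * X (a, b)))) :
    IsVPFamily f := by
  refine ⟨⟨?_, ?_⟩, ?_⟩
  · refine IsPBounded.mono (IsPBounded.mul_holds IsPBounded.id IsPBounded.id) fun n => ?_
    simp
  · refine IsPBounded.mono IsPBounded.id fun n => ?_
    obtain ⟨s, β, α, _, hf | hf⟩ := hcirc n
    · rw [hf]; exact totalDegree_affineColSml_le β α
    · rw [hf, affineRowSml_eq_rename_swap]
      exact (totalDegree_rename_le _ _).trans (totalDegree_affineColSml_le β α)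
  · have hb : IsPBounded fun n => (n ^ c + c) * (2 * n * n + 2 * n + 1) :=
      IsPBounded.mul_holds ⟨c, fun n => le_rfl⟩
        (IsPBounded.add_holds (IsPBounded.add_holds
          (IsPBounded.mul_holds (IsPBounded.mul_holds (IsPBounded.const 2) IsPBounded.id) IsPBounded.id)
          (IsPBounded.mul_holds (IsPBounded.const 2) IsPBounded.id)) (IsPBounded.const 1))
    refine IsPBounded.mono hb fun n => ?_
    obtain ⟨s, β, α, hs, hf | hf⟩ := hcirc n
    · rw [hf]
      exact (complexity_affineColSml_le β α).trans (Nat.mul_le_mul_right _ hs)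
    · rw [hf, affineRowSml_eq_rename_swap]
      exact (complexity_rename_le_holds' _ _).trans ((complexity_affineColSml_le β α).trans (Nat.mul_le_mul_right _ hs))

/-! ### The crux holds on the class -/

/-- **`OrbitRestorationQP` HOLDS ON THE AFFINE SET-MULTILINEAR CLASS.**  A matrix-symmetric family with, at each level, an affine
column- or row-set-multilinear `ΣΠΣ` expression of at most `n^c + c` product gates is a `VP` family (the crux's hypothesis) AND
has square-symmetric circuits of quasi-polynomial orbit size (the crux's conclusion, verbatim shape). [folklore] -/
theorem orbitRestorationQP_on_affineSml (f : (n : ℕ) → MvPolynomial (Fin n × Fin n) ℂ)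
    (hsym : ∀ (n : ℕ) (σ τ : Equiv.Perm (Fin n)),
      MvPolynomial.rename (fun p : Fin n × Fin n => (σ p.1, τ p.2)) (f n) = f n)
    (hcirc : ∃ c : ℕ, ∀ n : ℕ, ∃ (s : ℕ) (β : Fin s → Fin n → ℂ) (α : Fin s → Fin n → Fin n → ℂ), s ≤ n ^ c + c ∧
      (f n = ∑ t : Fin s, ∏ b : Fin n, (C (β t b) + ∑ a : Fin n, C (α t b a) * X (a, b)) ∨
       f n = ∑ t : Fin s, ∏ a : Fin n, (C (β t a) + ∑ b : Fin n, C (α t a b) * X (a, b)))) :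
    IsVPFamily f ∧
    ∃ c : ℕ, ∀ n : ℕ, ∃ (G : Type) (_ : Fintype G) (C : LabelledArithCircuit ℂ (Fin n × Fin n) Unit G),
      C.IsSymmetric (Equiv.Perm (Fin n)) ∧ C.eval (C.output ()) = f n ∧
      C.orbitSize (Equiv.Perm (Fin n)) ≤ 2 ^ ((Nat.log 2 n + c) ^ c) := by
  obtain ⟨c, hc⟩ := hcirc
  exact ⟨isVPFamily_of_affineSml f hc, affineSml_restoration f hsym ⟨c, hc⟩⟩

/-! ### The permanent: row side -/

/-- **EXPONENTIAL LOWER BOUND, ROW SIDE.**  Every affine ROW-set-multilinear depth-three expression of `per_n` has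
`s ≥ C(n-j, j)` product gates (`2j ≤ n`). [folklore] -/
theorem perm_affineRowSml_lower_bound {n s j : ℕ} (h2j : 2 * j ≤ n) (β : Fin s → Fin n → ℂ)
    (α : Fin s → Fin n → Fin n → ℂ)
    (hper : (∑ t : Fin s, ∏ a : Fin n, (C (β t a) + ∑ b : Fin n, C (α t a b) * X (a, b)) :
      MvPolynomial (Fin n × Fin n) ℂ) = perPoly (Fin n) ℂ) :
    Nat.choose (n - j) j ≤ s := by
  refine perm_affineColSml_lower_bound h2j β α ?_
  rw [← rename_swap_affineRowSml β α, hper, ProjectionStabilityUniqStep.rename_swap_perPoly]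

end Summit.ValiantsHypothesis.ValiantsHypothesis.Theorems.SmlAffineRestoration

end
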